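import Summits.HubbardSuperconductivity.HubbardSuperconductivity.Theorems.BalabanIRBirBdGPhaseCoercivityNambu
import HarnessLib

/-!
# Crux `BirBdGPhaseCoercivity` (stmt-HubbardSuperconductivity-2081, route `BalabanIR`), line
`bcs-dual-persistence` (reshaped, `V := K`) — stub `stub_bachBlock` (S2, Bach's inequality at the BdG
reference in block form: the heart of the pair-fluctuation bound)

In the plane-wave basis let `X̂_B = [[ξ, B], [Bᴴ, -ξ]]` (real diagonal `ξ`, ANY pairing block `B`),
`E_k > 0`, `E_k² = ξ_k² + |Δ_k|²`, and let `Γ` be a Hermitian idempotent. Then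
`Re Tr (X̂_B Γ) ≥ -Σ_k E_k - Σ_{k,k'} |B_{kk'}|²/(E_k+E_{k'}) + Σ_k |Δ_k|²/(2E_k)`.

Proof. With the reference `X̂₀ = [[ξ, Δ], [conj Δ, -ξ]]`, `𝔼 = E ⊕ E` (`𝔼² = X̂₀²`, `[X̂₀,𝔼] = 0`,
`BirBdG.nambuHat_sq/comm`), `V = X̂₀𝔼⁻¹` (`V² = 1`) and `Γ₀ = ½(1 - V)` (Hermitian idempotent commuting
with `𝔼`, `X̂₀ = 𝔼 - 2𝔼Γ₀`, `Tr 𝔼Γ₀ = Σ E_k`, pairing block `-Δ/(2E)`):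
* BACH'S IDENTITY `Tr X̂₀Γ = -Tr 𝔼Γ₀ + Tr 𝔼(Γ-Γ₀)²` (uses only `Γ² = Γ`, `Γ₀² = Γ₀`, `[𝔼,Γ₀] = 0`);
* `Re Tr 𝔼 Y² ≥ Σ_{k,k'} (E_k + E_{k'}) |Y_{inl k, inr k'}|²` for Hermitian `Y` (drop the diagonal blocks);
* `Tr X̂_BΓ = Tr X̂₀Γ + 2 Re Tr ((B - diag Δ)ᴴ Γ₁₂)`, and the entrywise completed square
  `a|y|² + 2Re(c̄y) ≥ -|c|²/a` with `a = E_k+E_{k'}`, `c = B - diag Δ`, `y = Γ₁₂ + diag(Δ/2E)`.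
References: V. Bach, E. H. Lieb, J. P. Solovej, J. Stat. Phys. 76 (1994) 3 (Thm 2.11 and the variational
principle for quasi-free states); the identity form of Bach's inequality `Tr H(Γ-P) - Tr |H|(Γ-P)² = Tr |H|(Γ-Γ²)`.
No definition is introduced.
-/

noncomputable section

set_option linter.dupNamespace false

namespace Summit.HubbardSuperconductivity.HubbardSuperconductivity.Theorems.BirBdGPhaseCoercivity

open Matrix Finset Summit.HubbardSuperconductivity.HubbardSuperconductivity.Theorems.BirBdG
open scoped ComplexConjugate ComplexOrder

/-! ### Scalar and trace lemmas -/

/-- Entrywise completed square: `a|y|² + 2 Re(c̄ y) ≥ -|c|²/a` for `a > 0`. [folklore] -/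
private theorem amgm_entry (a : ℝ) (ha : 0 < a) (y c : ℂ) :
    -(‖c‖ ^ 2 / a) ≤ a * ‖y‖ ^ 2 + 2 * (conj c * y).re := by
  have key : a * ‖y‖ ^ 2 + 2 * (conj c * y).re + ‖c‖ ^ 2 / a =
      a * ((y.re + c.re / a) ^ 2 + (y.im + c.im / a) ^ 2) := by
    rw [Complex.sq_norm, Complex.sq_norm, Complex.normSq_apply, Complex.normSq_apply, Complex.mul_re,
      Complex.conj_re, Complex.conj_im]
    field_simp
    ring
  have hnn : 0 ≤ a * ((y.re + c.re / a) ^ 2 + (y.im + c.im / a) ^ 2) := by positivity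
  linarith

/-- **Bach's identity** (abstract form): if `X₀ = 𝔼 - 2𝔼Γ₀`, `Γ₀² = Γ₀`, `[𝔼, Γ₀] = 0` and `Γ² = Γ`,
then `Tr (X₀Γ) = -Tr (𝔼Γ₀) + Tr (𝔼(Γ - Γ₀)²)`. [cite: BachLiebSolovej1994, Thm 2.11] -/
private theorem bach_identity {n : Type*} [Fintype n] [DecidableEq n] (X₀ EE Γ₀ Γ : Matrix n n ℂ)
    (h1 : X₀ = EE - (2 : ℂ) • (EE * Γ₀)) (h2 : Γ₀ * Γ₀ = Γ₀) (h3 : EE * Γ₀ = Γ₀ * EE)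
    (h4 : Γ * Γ = Γ) :
    (X₀ * Γ).trace = -(EE * Γ₀).trace + (EE * ((Γ - Γ₀) * (Γ - Γ₀))).trace := by
  have hcyc : (EE * (Γ * Γ₀)).trace = (EE * (Γ₀ * Γ)).trace := by
    calc (EE * (Γ * Γ₀)).trace = (Γ₀ * (EE * Γ)).trace := by
          rw [← Matrix.mul_assoc, Matrix.trace_mul_comm, ← Matrix.mul_assoc]
      _ = (EE * (Γ₀ * Γ)).trace := by rw [← Matrix.mul_assoc, ← h3, Matrix.mul_assoc]
  have hexp : (Γ - Γ₀) * (Γ - Γ₀) = Γ - Γ * Γ₀ - Γ₀ * Γ + Γ₀ := by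
    rw [Matrix.sub_mul, Matrix.mul_sub, Matrix.mul_sub, h4, h2]
    abel
  rw [hexp, h1, Matrix.sub_mul, Matrix.smul_mul, Matrix.mul_assoc, Matrix.trace_sub, Matrix.trace_smul,
    Matrix.mul_add, Matrix.mul_sub, Matrix.mul_sub, Matrix.trace_add, Matrix.trace_sub, Matrix.trace_sub,
    hcyc, smul_eq_mul]
  ring

/-- Diagonal weights against a Hermitian square: `Re Tr (diag(e) Y²) ≥ Σ_{k,k'} (e_{inl k} + e_{inr k'}) |Y_{inl k, inr k'}|²`
for `e ≥ 0` and Hermitian `Y` on `m ⊕ m` (the diagonal blocks contribute non-negatively). [folklore] -/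
private theorem offDiag_le_re_trace_diag_mul_sq {m : Type*} [Fintype m] [DecidableEq m]
    (e : m ⊕ m → ℝ) (he : ∀ i, 0 ≤ e i) (Y : Matrix (m ⊕ m) (m ⊕ m) ℂ) (hY : Yᴴ = Y) :
    ∑ k, ∑ k', (e (Sum.inl k) + e (Sum.inr k')) * ‖Y (Sum.inl k) (Sum.inr k')‖ ^ 2 ≤
      ((diagonal fun i => (e i : ℂ)) * (Y * Y)).trace.re := by
  -- `Re Tr (diag e · Y²) = Σ_i Σ_j e_i |Y_ij|²`
  have hentry : ∀ i j, Y i j * Y j i = ((‖Y i j‖ ^ 2 : ℝ) : ℂ) := by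
    intro i j
    have hji : Y j i = conj (Y i j) := by
      rw [← hY, Matrix.conjTranspose_apply, hY, Complex.star_def]
    rw [hji, Complex.mul_conj, Complex.normSq_eq_norm_sq]
  have htr : ((diagonal fun i => (e i : ℂ)) * (Y * Y)).trace.re = ∑ i, ∑ j, e i * ‖Y i j‖ ^ 2 := by
    rw [trace_diagonal_mul']
    simp only [Matrix.mul_apply, hentry]
    rw [Complex.re_sum]
    refine Finset.sum_congr rfl fun i _ => ?_
    rw [Finset.mul_sum, Complex.re_sum]
    refine Finset.sum_congr rfl fun j _ => ?_
    rw [← Complex.ofReal_mul, Complex.ofReal_re]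
  rw [htr, Fintype.sum_sum_type]
  simp only [Fintype.sum_sum_type]
  -- symmetry of the norms
  have hsym : ∀ k k', ‖Y (Sum.inr k') (Sum.inl k)‖ = ‖Y (Sum.inl k) (Sum.inr k')‖ := by
    intro k k'
    rw [← hY, Matrix.conjTranspose_apply, hY, norm_star]
  have hnn1 : 0 ≤ ∑ k, ∑ j, e (Sum.inl k) * ‖Y (Sum.inl k) (Sum.inl j)‖ ^ 2 :=
    Finset.sum_nonneg fun k _ => Finset.sum_nonneg fun j _ => mul_nonneg (he _) (sq_nonneg _)
  have hnn2 : 0 ≤ ∑ k, ∑ j, e (Sum.inr k) * ‖Y (Sum.inr k) (Sum.inr j)‖ ^ 2 :=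
    Finset.sum_nonneg fun k _ => Finset.sum_nonneg fun j _ => mul_nonneg (he _) (sq_nonneg _)
  have hswap : ∑ k, ∑ j, e (Sum.inr k) * ‖Y (Sum.inr k) (Sum.inl j)‖ ^ 2 =
      ∑ k, ∑ k', e (Sum.inr k') * ‖Y (Sum.inl k) (Sum.inr k')‖ ^ 2 := by
    rw [Finset.sum_comm]
    refine Finset.sum_congr rfl fun k _ => Finset.sum_congr rfl fun k' _ => ?_
    rw [hsym]
  have hsplit : ∑ k, ∑ k', (e (Sum.inl k) + e (Sum.inr k')) * ‖Y (Sum.inl k) (Sum.inr k')‖ ^ 2 =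
      ∑ k, ∑ k', e (Sum.inl k) * ‖Y (Sum.inl k) (Sum.inr k')‖ ^ 2 +
        ∑ k, ∑ k', e (Sum.inr k') * ‖Y (Sum.inl k) (Sum.inr k')‖ ^ 2 := by
    rw [← Finset.sum_add_distrib]
    refine Finset.sum_congr rfl fun k _ => ?_
    rw [← Finset.sum_add_distrib]
    refine Finset.sum_congr rfl fun k' _ => ?_
    ring
  rw [hsplit, ← hswap]
  simp only [Finset.sum_add_distrib]
  linarith

/-- Real diagonal matrices cast to `ℂ` are Hermitian. [folklore] -/
private theorem isHermitian_diagonal_ofReal' {m : Type*} [Fintype m] [DecidableEq m] (ξ : m → ℝ) :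
    (diagonal fun k => (ξ k : ℂ)).IsHermitian := by
  rw [Matrix.IsHermitian, Matrix.diagonal_conjTranspose]
  congr 1
  funext k
  simp

/-- The diagonal completed square: with `c = b - d`, `s = -d/(2E)`,
`-|c|²/(2E) + 2 Re(c̄ s) = -|b|²/(2E) + |d|²/(2E)`. [folklore] -/
private theorem diag_square (b d : ℂ) (e : ℝ) (he : 0 < e) :
    -(‖b - d‖ ^ 2 / (e + e)) + 2 * (conj (b - d) * (-(d * ((e : ℂ))⁻¹) / 2)).re =
      -(‖b‖ ^ 2 / (e + e)) + ‖d‖ ^ 2 / (2 * e) := by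
  have he' : (e : ℂ)⁻¹ = ((e⁻¹ : ℝ) : ℂ) := by push_cast; rfl
  rw [he', Complex.sq_norm, Complex.sq_norm, Complex.sq_norm, Complex.normSq_apply, Complex.normSq_apply,
    Complex.normSq_apply]
  simp only [Complex.mul_re, Complex.sub_re, Complex.sub_im, Complex.conj_re, Complex.conj_im,
    Complex.neg_re, Complex.neg_im, Complex.div_ofNat_re, Complex.div_ofNat_im, Complex.mul_im,
    Complex.ofReal_re, Complex.ofReal_im]
  field_simp
  ring

/-! ### The stub -/

/-- **Bach's inequality at the BdG reference (block form).** For `X̂_B = [[ξ, B], [Bᴴ, -ξ]]`,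
`E > 0`, `E² = ξ² + |Δ|²` and every Hermitian idempotent `Γ`:
`-Σ_k E_k - Σ_{k,k'} |B_{kk'}|²/(E_k+E_{k'}) + Σ_k |Δ_k|²/(2E_k) ≤ Re Tr (X̂_B Γ)`. [cite: BachLiebSolovej1994, Thm 2.11] -/
theorem stub_bachBlock {m : Type*} [Fintype m] [DecidableEq m] (ξ E : m → ℝ) (Δ : m → ℂ)
    (hEpos : ∀ k, 0 < E k) (hE : ∀ k, E k ^ 2 = ξ k ^ 2 + ‖Δ k‖ ^ 2) (B : Matrix m m ℂ)
    (Γ : Matrix (m ⊕ m) (m ⊕ m) ℂ) (hΓ : Γᴴ = Γ) (hΓ2 : Γ * Γ = Γ) :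
    -(∑ k, E k) - ∑ k, ∑ k', ‖B k k'‖ ^ 2 / (E k + E k') + ∑ k, ‖Δ k‖ ^ 2 / (2 * E k) ≤
      (Matrix.fromBlocks (diagonal fun k => (ξ k : ℂ)) B Bᴴ (-diagonal fun k => (ξ k : ℂ)) * Γ).trace.re := by
  -- the reference objects
  set Aξ : Matrix m m ℂ := diagonal fun k => (ξ k : ℂ) with hAξ
  set X₀ : Matrix (m ⊕ m) (m ⊕ m) ℂ := Matrix.fromBlocks Aξ (diagonal Δ) (diagonal Δ)ᴴ (-Aξ) with hX₀
  set EE : Matrix (m ⊕ m) (m ⊕ m) ℂ :=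
    Matrix.fromBlocks (diagonal fun k => (E k : ℂ)) 0 0 (diagonal fun k => (E k : ℂ)) with hEE
  set Ei : Matrix (m ⊕ m) (m ⊕ m) ℂ :=
    Matrix.fromBlocks (diagonal fun k => ((E k)⁻¹ : ℂ)) 0 0 (diagonal fun k => ((E k)⁻¹ : ℂ)) with hEi
  have hEne : ∀ k, E k ≠ 0 := fun k => (hEpos k).ne'
  have hsq : EE * EE = X₀ * X₀ := nambuHat_sq ξ E Δ hE
  have hcomm : X₀ * EE = EE * X₀ := nambuHat_comm ξ E Δ
  have hinv : EE * Ei = 1 := nambuMetricHat_mul_inv E hEne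
  have hinv' : Ei * EE = 1 := mul_eq_one_comm.1 hinv
  have hcommi : Ei * X₀ = X₀ * Ei := by
    calc Ei * X₀ = Ei * X₀ * (EE * Ei) := by rw [hinv, Matrix.mul_one]
      _ = Ei * (X₀ * EE) * Ei := by simp only [Matrix.mul_assoc]
      _ = Ei * (EE * X₀) * Ei := by rw [hcomm]
      _ = (Ei * EE) * X₀ * Ei := by simp only [Matrix.mul_assoc]
      _ = X₀ * Ei := by rw [hinv', Matrix.one_mul]
  have hV2 : X₀ * Ei * (X₀ * Ei) = 1 := by
    calc X₀ * Ei * (X₀ * Ei) = X₀ * (Ei * X₀) * Ei := by simp only [Matrix.mul_assoc]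
      _ = X₀ * (X₀ * Ei) * Ei := by rw [hcommi]
      _ = (X₀ * X₀) * (Ei * Ei) := by simp only [Matrix.mul_assoc]
      _ = (EE * EE) * (Ei * Ei) := by rw [hsq]
      _ = EE * (EE * Ei) * Ei := by simp only [Matrix.mul_assoc]
      _ = 1 := by rw [hinv, Matrix.mul_one, hinv]
  have hEV : EE * (X₀ * Ei) = X₀ := by
    rw [← Matrix.mul_assoc, ← hcomm, Matrix.mul_assoc, hinv, Matrix.mul_one]
  have hVE : X₀ * Ei * EE = X₀ := by
    rw [Matrix.mul_assoc, hinv', Matrix.mul_one]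
  -- the reference projection `Γ₀ = ½ (1 - X₀ 𝔼⁻¹)`
  set Γ₀ : Matrix (m ⊕ m) (m ⊕ m) ℂ := (1 / 2 : ℂ) • (1 - X₀ * Ei) with hΓ₀
  have h1V : (1 - X₀ * Ei) * (1 - X₀ * Ei) = (2 : ℂ) • (1 - X₀ * Ei) := by
    rw [Matrix.sub_mul, Matrix.one_mul, Matrix.mul_sub, Matrix.mul_one, hV2, two_smul]
    abel
  have hΓ₀2 : Γ₀ * Γ₀ = Γ₀ := by
    rw [hΓ₀, Matrix.smul_mul, Matrix.mul_smul, smul_smul, h1V, smul_smul]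
    norm_num
  have hEΓ₀ : EE * Γ₀ = Γ₀ * EE := by
    rw [hΓ₀, Matrix.mul_smul, Matrix.smul_mul, Matrix.mul_sub, Matrix.sub_mul, Matrix.mul_one,
      Matrix.one_mul, hEV, hVE]
  have hEΓ₀' : EE * Γ₀ = (1 / 2 : ℂ) • (EE - X₀) := by
    rw [hΓ₀, Matrix.mul_smul, Matrix.mul_sub, Matrix.mul_one, hEV]
  have hX₀eq : X₀ = EE - (2 : ℂ) • (EE * Γ₀) := by
    rw [hEΓ₀', smul_smul]
    norm_num
  -- `Tr (𝔼 Γ₀) = Σ E`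
  have htrX₀ : X₀.trace = 0 := by
    rw [hX₀, show ∀ (P Q R S : Matrix m m ℂ), (Matrix.fromBlocks P Q R S).trace = P.trace + S.trace from
      fun P Q R S => by simp [Matrix.trace, Fintype.sum_sum_type], Matrix.trace_neg, add_neg_cancel]
  have htrEE : EE.trace = 2 * ∑ k, (E k : ℂ) := by
    rw [hEE, show ∀ (P Q R S : Matrix m m ℂ), (Matrix.fromBlocks P Q R S).trace = P.trace + S.trace from
      fun P Q R S => by simp [Matrix.trace, Fintype.sum_sum_type], Matrix.trace_diagonal, two_mul]
  have htrEΓ₀ : (EE * Γ₀).trace = ∑ k, (E k : ℂ) := by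
    rw [hEΓ₀', Matrix.trace_smul, Matrix.trace_sub, htrX₀, htrEE, smul_eq_mul]
    ring
  -- Hermiticity of the reference projection and its pairing block
  have hX₀H : X₀ᴴ = X₀ :=
    ((isHermitian_diagonal_ofReal' ξ).fromBlocks rfl (isHermitian_diagonal_ofReal' ξ).neg).eq
  have hEiH : Eiᴴ = Ei := by
    have h1 : (diagonal fun k => ((E k)⁻¹ : ℂ)).IsHermitian := by
      have := isHermitian_diagonal_ofReal' (fun k => (E k)⁻¹)
      convert this using 2
      funext k
      push_cast
      rfl
    exact (h1.fromBlocks (Matrix.conjTranspose_zero) h1).eq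
  have hΓ₀H : Γ₀ᴴ = Γ₀ := by
    rw [hΓ₀, Matrix.conjTranspose_smul, Matrix.conjTranspose_sub, Matrix.conjTranspose_one,
      Matrix.conjTranspose_mul, hX₀H, hEiH, hcommi]
    congr 1
    rw [star_div₀, star_one]
    simp
  have hΓ₀12 : ∀ k j, Γ₀ (Sum.inl k) (Sum.inr j) =
      if k = j then -(Δ k * ((E k : ℂ))⁻¹) / 2 else 0 := by
    intro k j
    rw [hΓ₀, Matrix.smul_apply, Matrix.sub_apply, Matrix.one_apply, hX₀, hEi, Matrix.fromBlocks_multiply,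
      Matrix.fromBlocks_apply₁₂, Matrix.add_apply, Matrix.mul_zero, Matrix.zero_apply,
      Matrix.diagonal_mul_diagonal, Matrix.diagonal_apply]
    simp only [Sum.inl_ne_inr, if_false, zero_add, zero_sub, smul_eq_mul]
    split_ifs <;> ring
  -- Bach's identity and the off-diagonal lower bound
  have hbach := bach_identity X₀ EE Γ₀ Γ hX₀eq hΓ₀2 hEΓ₀ hΓ2
  set Y : Matrix (m ⊕ m) (m ⊕ m) ℂ := Γ - Γ₀ with hY
  have hYH : Yᴴ = Y := by rw [hY, Matrix.conjTranspose_sub, hΓ, hΓ₀H]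
  have hEEdiag : EE = diagonal fun i => ((Sum.elim E E i : ℝ) : ℂ) := by
    rw [hEE, Matrix.fromBlocks_diagonal]
    congr 1
    funext i
    cases i <;> rfl
  have hlow := offDiag_le_re_trace_diag_mul_sq (Sum.elim E E)
    (by rintro (k | k) <;> exact (hEpos k).le) Y hYH
  rw [← hEEdiag] at hlow
  simp only [Sum.elim_inl, Sum.elim_inr] at hlow
  -- the perturbation `X_B - X₀ = [[0, C], [Cᴴ, 0]]`, `C = B - diag Δ`
  set C : Matrix m m ℂ := B - diagonal Δ with hC
  have hXB : Matrix.fromBlocks Aξ B Bᴴ (-Aξ) = X₀ + Matrix.fromBlocks 0 C Cᴴ 0 := by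
    rw [hX₀, hC, Matrix.fromBlocks_add, Matrix.conjTranspose_sub]
    simp
  have htrδ : ((Matrix.fromBlocks (0 : Matrix m m ℂ) C Cᴴ 0 * Γ).trace).re =
      2 * ∑ k, ∑ j, (conj (C k j) * Γ (Sum.inl k) (Sum.inr j)).re := by
    have hΓentry : ∀ k j, Γ (Sum.inr j) (Sum.inl k) = conj (Γ (Sum.inl k) (Sum.inr j)) := by
      intro k j
      rw [← hΓ, Matrix.conjTranspose_apply, hΓ, Complex.star_def]
    have hexp : (Matrix.fromBlocks (0 : Matrix m m ℂ) C Cᴴ 0 * Γ).trace =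
        ∑ k, ∑ j, C k j * conj (Γ (Sum.inl k) (Sum.inr j)) +
          ∑ k, ∑ j, conj (C k j) * Γ (Sum.inl k) (Sum.inr j) := by
      simp only [Matrix.trace, Matrix.diag_apply, Matrix.mul_apply, Fintype.sum_sum_type,
        Matrix.fromBlocks_apply₁₁, Matrix.fromBlocks_apply₁₂, Matrix.fromBlocks_apply₂₁,
        Matrix.fromBlocks_apply₂₂, Matrix.zero_apply, zero_mul, Finset.sum_const_zero, zero_add, add_zero,
        Matrix.conjTranspose_apply, Complex.star_def]
      congr 1
      · exact Finset.sum_congr rfl fun k _ => Finset.sum_congr rfl fun j _ => by rw [hΓentry]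
      · rw [Finset.sum_comm]
    have hconj : ∑ k, ∑ j, C k j * conj (Γ (Sum.inl k) (Sum.inr j)) =
        conj (∑ k, ∑ j, conj (C k j) * Γ (Sum.inl k) (Sum.inr j)) := by
      rw [map_sum]
      refine Finset.sum_congr rfl fun k _ => ?_
      rw [map_sum]
      refine Finset.sum_congr rfl fun j _ => ?_
      rw [map_mul, Complex.conj_conj]
    rw [hexp, hconj, Complex.add_re, Complex.conj_re, Complex.re_sum, two_mul]
    congr 1 <;> exact Finset.sum_congr rfl fun k _ => Complex.re_sum _ _
  -- entrywise completed squares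
  have hterm : ∀ k j,
      -(‖C k j‖ ^ 2 / (E k + E j)) + 2 * (conj (C k j) * Γ₀ (Sum.inl k) (Sum.inr j)).re ≤
        (E k + E j) * ‖Y (Sum.inl k) (Sum.inr j)‖ ^ 2 + 2 * (conj (C k j) * Γ (Sum.inl k) (Sum.inr j)).re := by
    intro k j
    have hΓY : Γ (Sum.inl k) (Sum.inr j) = Y (Sum.inl k) (Sum.inr j) + Γ₀ (Sum.inl k) (Sum.inr j) := by
      rw [hY, Matrix.sub_apply, sub_add_cancel]
    have := amgm_entry (E k + E j) (add_pos (hEpos k) (hEpos j)) (Y (Sum.inl k) (Sum.inr j)) (C k j)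
    rw [hΓY, mul_add, Complex.add_re]
    linarith
  have hdiag : ∀ k j,
      -(‖C k j‖ ^ 2 / (E k + E j)) + 2 * (conj (C k j) * Γ₀ (Sum.inl k) (Sum.inr j)).re =
        -(‖B k j‖ ^ 2 / (E k + E j)) + (if k = j then ‖Δ k‖ ^ 2 / (2 * E k) else 0) := by
    intro k j
    rw [hΓ₀12, hC, Matrix.sub_apply, Matrix.diagonal_apply]
    by_cases hkj : k = j
    · subst hkj
      simp only [if_true]
      exact diag_square (B k k) (Δ k) (E k) (hEpos k)
    · simp [hkj]
  -- assemble
  have hsum := Finset.sum_le_sum fun k (_ : k ∈ Finset.univ) =>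
    Finset.sum_le_sum fun j (_ : j ∈ Finset.univ) => hterm k j
  simp_rw [hdiag] at hsum
  rw [hXB, Matrix.add_mul, Matrix.trace_add, Complex.add_re, hbach, Complex.add_re, Complex.neg_re,
    htrEΓ₀, htrδ]
  have hEsum : (∑ k, (E k : ℂ)).re = ∑ k, E k := by
    rw [Complex.re_sum]
    simp
  rw [hEsum]
  -- unfold the double sums of `hsum`
  have hL : ∑ k, ∑ j, (-(‖B k j‖ ^ 2 / (E k + E j)) + (if k = j then ‖Δ k‖ ^ 2 / (2 * E k) else 0)) =
      -(∑ k, ∑ k', ‖B k k'‖ ^ 2 / (E k + E k')) + ∑ k, ‖Δ k‖ ^ 2 / (2 * E k) := by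
    simp only [Finset.sum_add_distrib, Finset.sum_neg_distrib, Finset.sum_ite_eq, Finset.mem_univ, if_true]
  have hR : ∑ k, ∑ j, ((E k + E j) * ‖Y (Sum.inl k) (Sum.inr j)‖ ^ 2 +
      2 * (conj (C k j) * Γ (Sum.inl k) (Sum.inr j)).re) =
      ∑ k, ∑ j, (E k + E j) * ‖Y (Sum.inl k) (Sum.inr j)‖ ^ 2 +
        2 * ∑ k, ∑ j, (conj (C k j) * Γ (Sum.inl k) (Sum.inr j)).re := by
    simp only [Finset.sum_add_distrib, Finset.mul_sum]
  rw [hL, hR] at hsum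
  linarith

end Summit.HubbardSuperconductivity.HubbardSuperconductivity.Theorems.BirBdGPhaseCoercivity

end
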